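import Summits.KontsevichZagierPeriods.KontsevichZagierPeriods.Theorems.RootDecompZetaThreeFrontierWordMatchPreludeP10

/-! # `RootDecompZetaThreeFrontierWordMatchPreludeP11` — part 3/6 of the mechanical ≤340-line split of `src.lean`
(split by the decomp-kz census seat for landing; mathematics unchanged; part 3 continues part 2). -/

set_option linter.dupNamespace false

noncomputable section

namespace Summit.KontsevichZagierPeriods.KontsevichZagierPeriods.Cruxes.GZNormalFormWThree.GZLadder
open Set MeasureTheory Literature.NumberTheory.Transcendental
open Summit.KontsevichZagierPeriods.RootDecompZetaThreeFrontier
open Summit.KontsevichZagierPeriods.KontsevichZagierPeriods.Theorems.RootDecompZetaThreeFrontierWordMoves (measurableSet_simplex ibpQ1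
  dualRep3 dualRep3_integrand mem_simplex_three_duΦ integrableOn_comp_duΦ)

/-- **γ₁-PRESERVING t₁-LOWERING STEP** (`β₁ = b+1 ↦ b`, `γ₁ = c+1` kept). -/
theorem lowerT1' (N : MvPolynomial (Fin 3) ℚ) (β₀ b c γ₂ α : ℕ) (hb : 1 ≤ b)
    (hRint : IntegrableOn (WordLayer.layerF (WordLayer.lowR1' N b c) β₀ b (c + 1) γ₂ α) (KZ.openOrderedSimplex 3))
    (hR : ∀ s : KZ.IntegralRep 3, s.domain = simplex 3 →
      EqOn s.integrand (WordLayer.layerF (WordLayer.lowR1' N b c) β₀ b (c + 1) γ₂ α) s.domain → CongInto (layerThree ∪ gzLETwo) (KZ.of s))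
    (r : KZ.IntegralRep 3) (hd : r.domain = simplex 3) (hi : EqOn r.integrand (WordLayer.layerF N β₀ (b + 1) (c + 1) γ₂ α) r.domain) :
    CongInto (layerThree ∪ gzLETwo) (KZ.of r) := by
  have hrint : IntegrableOn (WordLayer.layerF N β₀ (b + 1) (c + 1) γ₂ α) (KZ.openOrderedSimplex 3) := by
    have h := r.integrableOn
    rw [hd] at h
    exact h.congr_fun (fun z hz => hi (by rw [hd]; exact hz)) (measurableSet_simplex 3)
  let rR := WordLayer.repThree _ (WordLayer.layerF_sa (WordLayer.lowR1' N b c) β₀ b (c + 1) γ₂ α) hRint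
  let rT := WordLayer.repThree (fun z => WordLayer.layerF N β₀ (b + 1) (c + 1) γ₂ α z - WordLayer.layerF (WordLayer.lowR1' N b c) β₀ b (c + 1) γ₂ α z)
    (IsSemialgebraicFunOn.sub_holds (WordLayer.layerF_sa N β₀ (b + 1) (c + 1) γ₂ α) (WordLayer.layerF_sa (WordLayer.lowR1' N b c) β₀ b (c + 1) γ₂ α))
    (hrint.sub hRint)
  refine WordLayer.of_add_split3 _ r rT rR hd rfl rfl (fun z hz => ?_) ?_ (hR rR rfl fun _ _ => rfl)
  · rw [hi (by rw [hd]; exact hz)]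
    simp [rT, rR, WordLayer.repThree]
  · exact congInto_of_ibpT1 (MvPolynomial.C (-(1 / (b : ℚ))) * N) β₀ b c γ₂ α rT rfl fun z hz =>
      WordLayer.lowerT1'_identity N β₀ b c γ₂ α hb hz

/-- **DUAL t₁-LOWERING STEP** (`γ₁ = c+1 ↦ c`, `β₁ ↦ β₁+1`; σ₃-conjugate of `lowerT1`). -/
theorem lowerT1d (N : MvPolynomial (Fin 3) ℚ) (β₀ β₁ c γ₂ α : ℕ) (hc : 1 ≤ c)
    (hRint : IntegrableOn (WordLayer.layerF (WordLayer.lowR1d N β₁ c) β₀ (β₁ + 1) c γ₂ α) (KZ.openOrderedSimplex 3))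
    (hR : ∀ s : KZ.IntegralRep 3, s.domain = simplex 3 →
      EqOn s.integrand (WordLayer.layerF (WordLayer.lowR1d N β₁ c) β₀ (β₁ + 1) c γ₂ α) s.domain → CongInto (layerThree ∪ gzLETwo) (KZ.of s))
    (r : KZ.IntegralRep 3) (hd : r.domain = simplex 3) (hi : EqOn r.integrand (WordLayer.layerF N β₀ β₁ (c + 1) γ₂ α) r.domain) :
    CongInto (layerThree ∪ gzLETwo) (KZ.of r) := by
  refine congInto_of_dual _ r hd (lowerT1 (WordLayer.duP3 N) γ₂ c β₁ β₀ α hc ?_ (fun s hs hsi => ?_) (dualRep3 r hd) rfl fun t ht => ?_)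
  · refine (integrableOn_comp_duΦ hRint).congr_fun (fun t _ => ?_) (measurableSet_simplex 3)
    show WordLayer.layerF (WordLayer.lowR1d N β₁ c) β₀ (β₁ + 1) c γ₂ α _ = _
    rw [layerF_duΦ, WordLayer.lowR1d, WordLayer.duP3_duP3]
  · refine congInto_of_dual _ s hs (hR (dualRep3 s hs) rfl fun t ht => ?_)
    rw [dualRep3_integrand, hsi (by rw [hs]; exact mem_simplex_three_duΦ ht), layerF_duΦ, WordLayer.lowR1d]
  · rw [dualRep3_integrand, hi (by rw [hd]; exact mem_simplex_three_duΦ ht), layerF_duΦ]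

/-- **DUAL β₁-PRESERVING t₁-LOWERING STEP** (`γ₁ = c+1 ↦ c`, `β₁ = b+1` kept; σ₃-conjugate of `lowerT1'`). -/
theorem lowerT1d' (N : MvPolynomial (Fin 3) ℚ) (β₀ b c γ₂ α : ℕ) (hc : 1 ≤ c)
    (hRint : IntegrableOn (WordLayer.layerF (WordLayer.lowR1d' N c b) β₀ (b + 1) c γ₂ α) (KZ.openOrderedSimplex 3))
    (hR : ∀ s : KZ.IntegralRep 3, s.domain = simplex 3 →
      EqOn s.integrand (WordLayer.layerF (WordLayer.lowR1d' N c b) β₀ (b + 1) c γ₂ α) s.domain → CongInto (layerThree ∪ gzLETwo) (KZ.of s))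
    (r : KZ.IntegralRep 3) (hd : r.domain = simplex 3) (hi : EqOn r.integrand (WordLayer.layerF N β₀ (b + 1) (c + 1) γ₂ α) r.domain) :
    CongInto (layerThree ∪ gzLETwo) (KZ.of r) := by
  refine congInto_of_dual _ r hd (lowerT1' (WordLayer.duP3 N) γ₂ c b β₀ α hc ?_ (fun s hs hsi => ?_) (dualRep3 r hd) rfl fun t ht => ?_)
  · refine (integrableOn_comp_duΦ hRint).congr_fun (fun t _ => ?_) (measurableSet_simplex 3)
    show WordLayer.layerF (WordLayer.lowR1d' N c b) β₀ (b + 1) c γ₂ α _ = _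
    rw [layerF_duΦ, WordLayer.lowR1d', WordLayer.duP3_duP3]
  · refine congInto_of_dual _ s hs (hR (dualRep3 s hs) rfl fun t ht => ?_)
    rw [dualRep3_integrand, hsi (by rw [hs]; exact mem_simplex_three_duΦ ht), layerF_duΦ, WordLayer.lowR1d']
  · rw [dualRep3_integrand, hi (by rw [hd]; exact mem_simplex_three_duΦ ht), layerF_duΦ]

end Summit.KontsevichZagierPeriods.KontsevichZagierPeriods.Cruxes.GZNormalFormWThree.GZLadder

/-! # §35  GENERIC STEP LEMMAS (decomp-kz lens-1 gen 11): the recursion behind `GapClassMatch` in bookkeeping form.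
Every step of the lowering procedure (exp/avail3.py + fix.py: verified to resolve ALL 24870 admissible non-layer classes with |κ| ≤ 4 and
exponents ≤ 4 inside that box) is ONE of:
* an ENGINE STEP `stepT2 / stepT1 / stepT0`: a pointwise identity on `Δ₃`, `N/den(B) = (engine image of P) + R/den(B')`, with the remainder
  class integrable and already `CongInto`;
* an ALGEBRAIC SPLIT `stepA2 / stepA3`: `N/den(B) = R₁/den(B₁) + R₂/den(B₂) (+ R₃/den(B₃))` pointwise with every piece integrable and `CongInto`;
* a FREE step (§34) or the LAYER terminal case (§28 `gapClassMatch_layer`).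
The identity is discharged each time by `simp [layerF, …]; field_simp; ring`; what remains for `GapClassMatch` is the well-founded bookkeeping. -/

namespace Summit.KontsevichZagierPeriods.KontsevichZagierPeriods.Cruxes.GZNormalFormWThree.GZLadder

open Set MeasureTheory Literature.NumberTheory.Transcendental
open Summit.KontsevichZagierPeriods.RootDecompZetaThreeFrontier
open Summit.KontsevichZagierPeriods.KontsevichZagierPeriods.Theorems.RootDecompZetaThreeFrontierWordMoves (measurableSet_simplex ibpQ1)

/-- a layer-shaped class given by an explicit numerator/exponent vector is integrable on `Δ₃` as soon as SOME rep carries it -/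
theorem integrableOn_layerF_of_rep (N : MvPolynomial (Fin 3) ℚ) (β₀ β₁ γ₁ γ₂ α : ℕ) (r : KZ.IntegralRep 3) (hd : r.domain = simplex 3)
    (hi : EqOn r.integrand (WordLayer.layerF N β₀ β₁ γ₁ γ₂ α) r.domain) :
    IntegrableOn (WordLayer.layerF N β₀ β₁ γ₁ γ₂ α) (KZ.openOrderedSimplex 3) := by
  have h := r.integrableOn
  rw [hd] at h
  exact h.congr_fun (fun z hz => hi (by rw [hd]; exact hz)) (measurableSet_simplex 3)

/-- **ALGEBRAIC SPLIT into two pieces.** -/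
theorem stepA2 (N R₁ R₂ : MvPolynomial (Fin 3) ℚ) (b0 b1 c1 c2 al d0 d1 e1 e2 da f0 f1 g1 g2 fa : ℕ)
    (hId : ∀ t ∈ KZ.openOrderedSimplex 3, WordLayer.layerF N b0 b1 c1 c2 al t =
      WordLayer.layerF R₁ d0 d1 e1 e2 da t + WordLayer.layerF R₂ f0 f1 g1 g2 fa t)
    (h₁int : IntegrableOn (WordLayer.layerF R₁ d0 d1 e1 e2 da) (KZ.openOrderedSimplex 3))
    (h₁ : ∀ s : KZ.IntegralRep 3, s.domain = simplex 3 → EqOn s.integrand (WordLayer.layerF R₁ d0 d1 e1 e2 da) s.domain →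
      CongInto (layerThree ∪ gzLETwo) (KZ.of s))
    (h₂int : IntegrableOn (WordLayer.layerF R₂ f0 f1 g1 g2 fa) (KZ.openOrderedSimplex 3))
    (h₂ : ∀ s : KZ.IntegralRep 3, s.domain = simplex 3 → EqOn s.integrand (WordLayer.layerF R₂ f0 f1 g1 g2 fa) s.domain →
      CongInto (layerThree ∪ gzLETwo) (KZ.of s))
    (r : KZ.IntegralRep 3) (hd : r.domain = simplex 3) (hi : EqOn r.integrand (WordLayer.layerF N b0 b1 c1 c2 al) r.domain) :
    CongInto (layerThree ∪ gzLETwo) (KZ.of r) := by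
  let r₁ := WordLayer.repThree _ (WordLayer.layerF_sa R₁ d0 d1 e1 e2 da) h₁int
  let r₂ := WordLayer.repThree _ (WordLayer.layerF_sa R₂ f0 f1 g1 g2 fa) h₂int
  refine WordLayer.of_add_split3 _ r r₁ r₂ hd rfl rfl (fun z hz => ?_) (h₁ r₁ rfl fun _ _ => rfl) (h₂ r₂ rfl fun _ _ => rfl)
  rw [hi (by rw [hd]; exact hz)]
  simpa [r₁, r₂, WordLayer.repThree] using hId z hz

/-- **ALGEBRAIC SPLIT into three pieces.** -/
theorem stepA3 (N R₁ R₂ R₃ : MvPolynomial (Fin 3) ℚ) (b0 b1 c1 c2 al d0 d1 e1 e2 da f0 f1 g1 g2 fa i0 i1 j1 j2 ia : ℕ)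
    (hId : ∀ t ∈ KZ.openOrderedSimplex 3, WordLayer.layerF N b0 b1 c1 c2 al t =
      WordLayer.layerF R₁ d0 d1 e1 e2 da t + WordLayer.layerF R₂ f0 f1 g1 g2 fa t + WordLayer.layerF R₃ i0 i1 j1 j2 ia t)
    (h₁int : IntegrableOn (WordLayer.layerF R₁ d0 d1 e1 e2 da) (KZ.openOrderedSimplex 3))
    (h₁ : ∀ s : KZ.IntegralRep 3, s.domain = simplex 3 → EqOn s.integrand (WordLayer.layerF R₁ d0 d1 e1 e2 da) s.domain →
      CongInto (layerThree ∪ gzLETwo) (KZ.of s))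
    (h₂int : IntegrableOn (WordLayer.layerF R₂ f0 f1 g1 g2 fa) (KZ.openOrderedSimplex 3))
    (h₂ : ∀ s : KZ.IntegralRep 3, s.domain = simplex 3 → EqOn s.integrand (WordLayer.layerF R₂ f0 f1 g1 g2 fa) s.domain →
      CongInto (layerThree ∪ gzLETwo) (KZ.of s))
    (h₃int : IntegrableOn (WordLayer.layerF R₃ i0 i1 j1 j2 ia) (KZ.openOrderedSimplex 3))
    (h₃ : ∀ s : KZ.IntegralRep 3, s.domain = simplex 3 → EqOn s.integrand (WordLayer.layerF R₃ i0 i1 j1 j2 ia) s.domain →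
      CongInto (layerThree ∪ gzLETwo) (KZ.of s))
    (r : KZ.IntegralRep 3) (hd : r.domain = simplex 3) (hi : EqOn r.integrand (WordLayer.layerF N b0 b1 c1 c2 al) r.domain) :
    CongInto (layerThree ∪ gzLETwo) (KZ.of r) := by
  let r₁₂ := WordLayer.repThree (fun z => WordLayer.layerF R₁ d0 d1 e1 e2 da z + WordLayer.layerF R₂ f0 f1 g1 g2 fa z)
    (IsSemialgebraicFunOn.add_holds (WordLayer.layerF_sa R₁ d0 d1 e1 e2 da) (WordLayer.layerF_sa R₂ f0 f1 g1 g2 fa)) (h₁int.add h₂int)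
  let r₁ := WordLayer.repThree _ (WordLayer.layerF_sa R₁ d0 d1 e1 e2 da) h₁int
  let r₂ := WordLayer.repThree _ (WordLayer.layerF_sa R₂ f0 f1 g1 g2 fa) h₂int
  let r₃ := WordLayer.repThree _ (WordLayer.layerF_sa R₃ i0 i1 j1 j2 ia) h₃int
  have h₁₂ : CongInto (layerThree ∪ gzLETwo) (KZ.of r₁₂) :=
    WordLayer.of_add_split3 _ r₁₂ r₁ r₂ rfl rfl rfl (fun z hz => by simp [r₁₂, r₁, r₂, WordLayer.repThree])
      (h₁ r₁ rfl fun _ _ => rfl) (h₂ r₂ rfl fun _ _ => rfl)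
  refine WordLayer.of_add_split3 _ r r₁₂ r₃ hd rfl rfl (fun z hz => ?_) h₁₂ (h₃ r₃ rfl fun _ _ => rfl)
  rw [hi (by rw [hd]; exact hz)]
  simpa [r₁₂, r₃, WordLayer.repThree, add_assoc] using hId z hz

/-- **GENERIC t₂-ENGINE STEP**: `N/den(B) = ibpQ(P;g,a)/den(b0,b1,c1,g+1,a+1) + R/den(B')` pointwise, remainder integrable and `CongInto`
⟹ `N/den(B)` is `CongInto`. -/
theorem stepT2 (N P R : MvPolynomial (Fin 3) ℚ) (b0 b1 c1 c2 al g a d0 d1 e1 e2 da : ℕ)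
    (hId : ∀ t ∈ KZ.openOrderedSimplex 3, WordLayer.layerF N b0 b1 c1 c2 al t =
      WordLayer.layerF (WordLayer.ibpQ P g a) b0 b1 c1 (g + 1) (a + 1) t + WordLayer.layerF R d0 d1 e1 e2 da t)
    (hRint : IntegrableOn (WordLayer.layerF R d0 d1 e1 e2 da) (KZ.openOrderedSimplex 3))
    (hR : ∀ s : KZ.IntegralRep 3, s.domain = simplex 3 → EqOn s.integrand (WordLayer.layerF R d0 d1 e1 e2 da) s.domain →
      CongInto (layerThree ∪ gzLETwo) (KZ.of s))
    (r : KZ.IntegralRep 3) (hd : r.domain = simplex 3) (hi : EqOn r.integrand (WordLayer.layerF N b0 b1 c1 c2 al) r.domain) :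
    CongInto (layerThree ∪ gzLETwo) (KZ.of r) := by
  have hrint := integrableOn_layerF_of_rep N b0 b1 c1 c2 al r hd hi
  let rR := WordLayer.repThree _ (WordLayer.layerF_sa R d0 d1 e1 e2 da) hRint
  let rT := WordLayer.repThree (fun z => WordLayer.layerF N b0 b1 c1 c2 al z - WordLayer.layerF R d0 d1 e1 e2 da z)
    (IsSemialgebraicFunOn.sub_holds (WordLayer.layerF_sa N b0 b1 c1 c2 al) (WordLayer.layerF_sa R d0 d1 e1 e2 da)) (hrint.sub hRint)
  refine WordLayer.of_add_split3 _ r rT rR hd rfl rfl (fun z hz => ?_) ?_ (hR rR rfl fun _ _ => rfl)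
  · rw [hi (by rw [hd]; exact hz)]
    simp [rT, rR, WordLayer.repThree]
  · exact congInto_of_ibpT2 P b0 b1 c1 g a rT rfl fun z hz => by
      show WordLayer.layerF N b0 b1 c1 c2 al z - WordLayer.layerF R d0 d1 e1 e2 da z = _
      rw [hId z hz]; ring

/-- **GENERIC t₁-ENGINE STEP**: `N/den(B) = ibpQ1(P;b,c)/den(b0,b+1,c+1,c2,al) + R/den(B')`. -/
theorem stepT1 (N P R : MvPolynomial (Fin 3) ℚ) (b0 b1 c1 c2 al b c d0 d1 e1 e2 da : ℕ)
    (hId : ∀ t ∈ KZ.openOrderedSimplex 3, WordLayer.layerF N b0 b1 c1 c2 al t =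
      WordLayer.layerF (ibpQ1 P b c) b0 (b + 1) (c + 1) c2 al t + WordLayer.layerF R d0 d1 e1 e2 da t)
    (hRint : IntegrableOn (WordLayer.layerF R d0 d1 e1 e2 da) (KZ.openOrderedSimplex 3))
    (hR : ∀ s : KZ.IntegralRep 3, s.domain = simplex 3 → EqOn s.integrand (WordLayer.layerF R d0 d1 e1 e2 da) s.domain →
      CongInto (layerThree ∪ gzLETwo) (KZ.of s))
    (r : KZ.IntegralRep 3) (hd : r.domain = simplex 3) (hi : EqOn r.integrand (WordLayer.layerF N b0 b1 c1 c2 al) r.domain) :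
    CongInto (layerThree ∪ gzLETwo) (KZ.of r) := by
  have hrint := integrableOn_layerF_of_rep N b0 b1 c1 c2 al r hd hi
  let rR := WordLayer.repThree _ (WordLayer.layerF_sa R d0 d1 e1 e2 da) hRint
  let rT := WordLayer.repThree (fun z => WordLayer.layerF N b0 b1 c1 c2 al z - WordLayer.layerF R d0 d1 e1 e2 da z)
    (IsSemialgebraicFunOn.sub_holds (WordLayer.layerF_sa N b0 b1 c1 c2 al) (WordLayer.layerF_sa R d0 d1 e1 e2 da)) (hrint.sub hRint)
  refine WordLayer.of_add_split3 _ r rT rR hd rfl rfl (fun z hz => ?_) ?_ (hR rR rfl fun _ _ => rfl)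
  · rw [hi (by rw [hd]; exact hz)]
    simp [rT, rR, WordLayer.repThree]
  · exact congInto_of_ibpT1 P b0 b c c2 al rT rfl fun z hz => by
      show WordLayer.layerF N b0 b1 c1 c2 al z - WordLayer.layerF R d0 d1 e1 e2 da z = _
      rw [hId z hz]; ring

/-- **GENERIC t₀-ENGINE STEP** (image numerator through `duP3`, as in `congInto_of_ibpT0`):
`N/den(B) = duP3(ibpQ(P;g,a))/den(g+1,b1,c1,c2,a+1) + R/den(B')`. -/
theorem stepT0 (N P R : MvPolynomial (Fin 3) ℚ) (b0 b1 c1 c2 al g a d0 d1 e1 e2 da : ℕ)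
    (hId : ∀ t ∈ KZ.openOrderedSimplex 3, WordLayer.layerF N b0 b1 c1 c2 al t =
      WordLayer.layerF (WordLayer.duP3 (WordLayer.ibpQ P g a)) (g + 1) b1 c1 c2 (a + 1) t + WordLayer.layerF R d0 d1 e1 e2 da t)
    (hRint : IntegrableOn (WordLayer.layerF R d0 d1 e1 e2 da) (KZ.openOrderedSimplex 3))
    (hR : ∀ s : KZ.IntegralRep 3, s.domain = simplex 3 → EqOn s.integrand (WordLayer.layerF R d0 d1 e1 e2 da) s.domain →
      CongInto (layerThree ∪ gzLETwo) (KZ.of s))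
    (r : KZ.IntegralRep 3) (hd : r.domain = simplex 3) (hi : EqOn r.integrand (WordLayer.layerF N b0 b1 c1 c2 al) r.domain) :
    CongInto (layerThree ∪ gzLETwo) (KZ.of r) := by
  have hrint := integrableOn_layerF_of_rep N b0 b1 c1 c2 al r hd hi
  let rR := WordLayer.repThree _ (WordLayer.layerF_sa R d0 d1 e1 e2 da) hRint
  let rT := WordLayer.repThree (fun z => WordLayer.layerF N b0 b1 c1 c2 al z - WordLayer.layerF R d0 d1 e1 e2 da z)
    (IsSemialgebraicFunOn.sub_holds (WordLayer.layerF_sa N b0 b1 c1 c2 al) (WordLayer.layerF_sa R d0 d1 e1 e2 da)) (hrint.sub hRint)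
  refine WordLayer.of_add_split3 _ r rT rR hd rfl rfl (fun z hz => ?_) ?_ (hR rR rfl fun _ _ => rfl)
  · rw [hi (by rw [hd]; exact hz)]
    simp [rT, rR, WordLayer.repThree]
  · exact congInto_of_ibpT0 P c2 c1 b1 g a rT rfl fun z hz => by
      show WordLayer.layerF N b0 b1 c1 c2 al z - WordLayer.layerF R d0 d1 e1 e2 da z = _
      rw [hId z hz]; ring

end Summit.KontsevichZagierPeriods.KontsevichZagierPeriods.Cruxes.GZNormalFormWThree.GZLadder

/-! # §36  Q-GENERIC ENGINE STEPS (decomp-kz lens-1 gen 11).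
The verified procedure (exp/: measure `μ = lex(P1, mx, S, |κ|)`, see NODE.md ADDENDUM 9) uses engine steps whose polynomial `P` is ANY solution
of the congruence `ibpQ(P) ≡ N' (mod f_w)` — i.e. `P = P₀ + f_w·Q` with the canonical `P₀` of §33–§34 and an arbitrary polynomial `Q`
(different `Q` = different remainder; the substituted / homogenised variants of the experiment are such `Q`).  Here are the four primal
steps with a free `Q` and explicit remainders, and their σ₃-duals:
* `lowerT2Q`  : `α = a+1 ↦ a`, `γ₂ = g ↦ g+1`,   remainder `lowR2Q  = lowR2  - corr2 Q g a`   over `den(β₀,β₁,γ₁,g+1,a)`;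
* `lowerC2Q`  : `γ₂ = g+1 ↦ g`, `α = a ↦ a+1`,   remainder `lowRc2Q = lowRc2 - corrC2 Q g a`  over `den(β₀,β₁,γ₁,g,a+1)`   (NEW direction: lowers γ₂);
* `lowerT1Q`  : `β₁ = b+1 ↦ b`, `γ₁ = c ↦ c+1`,   remainder `lowR1Q  = lowR1  - corr1 Q b c`   over `den(β₀,b,c+1,γ₂,α)`;
* `lowerT1'Q` : `β₁ = b+1 ↦ b`, `γ₁ = c+1` kept,   remainder `lowR1'Q = lowR1' - corr1 Q b c`   over `den(β₀,b,c+1,γ₂,α)`;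
* duals `lowerT0Q` (α ↦ α-1, β₀+1), `lowerB0Q` (β₀ ↦ β₀-1, α+1; NEW), `lowerT1dQ` (γ₁ ↦ γ₁-1, β₁+1), `lowerT1d'Q` (γ₁ ↦ γ₁-1, β₁ ≥ 1 kept). -/

namespace Summit.KontsevichZagierPeriods.RootDecompZetaThreeFrontier.WordLayer

open Set MeasureTheory Literature.NumberTheory.Transcendental
open Summit.KontsevichZagierPeriods.KontsevichZagierPeriods.Theorems.RootDecompZetaThreeFrontierWordMoves (mem_simplex_three_iff ibpQ1)

section QGeneric
open MvPolynomial

/-- correction of the t₂-remainder when `P` is shifted by `(X₀-X₂)·Q` -/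
noncomputable def corr2 (Q : MvPolynomial (Fin 3) ℚ) (g a : ℕ) : MvPolynomial (Fin 3) ℚ :=
  pderiv 2 ((X 0 - X 2) * Q) * (C 1 - X 2) + Q * (C (g : ℚ) * (X 0 - X 2) + C (a : ℚ) * (C 1 - X 2))

/-- correction of the t₂-remainder when `P` is shifted by `(1-X₂)·Q` -/
noncomputable def corrC2 (Q : MvPolynomial (Fin 3) ℚ) (g a : ℕ) : MvPolynomial (Fin 3) ℚ :=
  pderiv 2 ((C 1 - X 2) * Q) * (X 0 - X 2) + Q * (C (g : ℚ) * (X 0 - X 2) + C (a : ℚ) * (C 1 - X 2))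

/-- correction of the t₁-remainder when `P` is shifted by `X₁·Q` -/
noncomputable def corr1 (Q : MvPolynomial (Fin 3) ℚ) (b c : ℕ) : MvPolynomial (Fin 3) ℚ :=
  pderiv 1 (X 1 * Q) * (C 1 - X 1) + Q * (C (c : ℚ) * X 1 - C (b : ℚ) * (C 1 - X 1))

/-- the γ₂-lowering remainder numerator `-(1/g)(∂₂N·(t₀-t₂) + a N)` -/
noncomputable def lowRc2 (N : MvPolynomial (Fin 3) ℚ) (a g : ℕ) : MvPolynomial (Fin 3) ℚ :=
  -(C (1 / (g : ℚ)) * (pderiv 2 N * (X 0 - X 2) + C (a : ℚ) * N))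

/-- Auxiliary step `lowR2Q`. [bookkeeping] -/
noncomputable def lowR2Q (N Q : MvPolynomial (Fin 3) ℚ) (g a : ℕ) : MvPolynomial (Fin 3) ℚ := lowR2 N g a - corr2 Q g a
/-- Auxiliary step `lowRc2Q`. [bookkeeping] -/
noncomputable def lowRc2Q (N Q : MvPolynomial (Fin 3) ℚ) (g a : ℕ) : MvPolynomial (Fin 3) ℚ := lowRc2 N a g - corrC2 Q g a
/-- Auxiliary step `lowR1Q`. [bookkeeping] -/
noncomputable def lowR1Q (N Q : MvPolynomial (Fin 3) ℚ) (b c : ℕ) : MvPolynomial (Fin 3) ℚ := lowR1 N c b - corr1 Q b c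
/-- Auxiliary step `lowR1'Q`. [bookkeeping] -/
noncomputable def lowR1'Q (N Q : MvPolynomial (Fin 3) ℚ) (b c : ℕ) : MvPolynomial (Fin 3) ℚ := lowR1' N b c - corr1 Q b c
/-- σ₃-dual remainders -/
noncomputable def lowR0Q (N Q : MvPolynomial (Fin 3) ℚ) (g a : ℕ) : MvPolynomial (Fin 3) ℚ := duP3 (lowR2Q (duP3 N) (duP3 Q) g a)
/-- Auxiliary step `lowRb0Q`. [bookkeeping] -/
noncomputable def lowRb0Q (N Q : MvPolynomial (Fin 3) ℚ) (g a : ℕ) : MvPolynomial (Fin 3) ℚ := duP3 (lowRc2Q (duP3 N) (duP3 Q) g a)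
/-- Auxiliary step `lowR1dQ`. [bookkeeping] -/
noncomputable def lowR1dQ (N Q : MvPolynomial (Fin 3) ℚ) (b c : ℕ) : MvPolynomial (Fin 3) ℚ := duP3 (lowR1Q (duP3 N) (duP3 Q) b c)
/-- Auxiliary step `lowR1d'Q`. [bookkeeping] -/
noncomputable def lowR1d'Q (N Q : MvPolynomial (Fin 3) ℚ) (b c : ℕ) : MvPolynomial (Fin 3) ℚ := duP3 (lowR1'Q (duP3 N) (duP3 Q) b c)

/-- Auxiliary step `lowerT2Q_identity`. [bookkeeping] -/
theorem lowerT2Q_identity (N Q : MvPolynomial (Fin 3) ℚ) (β₀ β₁ γ₁ g a : ℕ) (ha : 1 ≤ a) {t : Fin 3 → ℝ}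
    (ht : t ∈ KZ.openOrderedSimplex 3) :
    layerF N β₀ β₁ γ₁ g (a + 1) t - layerF (lowR2Q N Q g a) β₀ β₁ γ₁ (g + 1) a t =
      layerF (ibpQ (C (1 / (a : ℚ)) * N + (X 0 - X 2) * Q) g a) β₀ β₁ γ₁ (g + 1) (a + 1) t := by
  obtain ⟨h0, h1, h1', h2', hd⟩ := simplex3_facts ht
  have ha' : (a : ℝ) ≠ 0 := by exact_mod_cast (show a ≠ 0 by omega)
  simp only [layerF, lowR2Q, lowR2, corr2, ibpQ, MvPolynomial.pderiv_C_mul, map_add, map_mul, map_sub, map_neg, MvPolynomial.aeval_C,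
    MvPolynomial.aeval_X, map_natCast, map_one, one_div, eq_ratCast, Rat.cast_inv, Rat.cast_natCast]
  field_simp
  ring

/-- Auxiliary step `lowerC2Q_identity`. [bookkeeping] -/
theorem lowerC2Q_identity (N Q : MvPolynomial (Fin 3) ℚ) (β₀ β₁ γ₁ g a : ℕ) (hg : 1 ≤ g) {t : Fin 3 → ℝ}
    (ht : t ∈ KZ.openOrderedSimplex 3) :
    layerF N β₀ β₁ γ₁ (g + 1) a t - layerF (lowRc2Q N Q g a) β₀ β₁ γ₁ g (a + 1) t =
      layerF (ibpQ (C (1 / (g : ℚ)) * N + (C 1 - X 2) * Q) g a) β₀ β₁ γ₁ (g + 1) (a + 1) t := by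
  obtain ⟨h0, h1, h1', h2', hd⟩ := simplex3_facts ht
  have hg' : (g : ℝ) ≠ 0 := by exact_mod_cast (show g ≠ 0 by omega)
  simp only [layerF, lowRc2Q, lowRc2, corrC2, ibpQ, MvPolynomial.pderiv_C_mul, map_add, map_mul, map_sub, map_neg, MvPolynomial.aeval_C,
    MvPolynomial.aeval_X, map_natCast, map_one, one_div, eq_ratCast, Rat.cast_inv, Rat.cast_natCast]
  field_simp
  ring

/-- Auxiliary step `lowerT1Q_identity`. [bookkeeping] -/
theorem lowerT1Q_identity (N Q : MvPolynomial (Fin 3) ℚ) (β₀ b c γ₂ α : ℕ) (hb : 1 ≤ b) {t : Fin 3 → ℝ}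
    (ht : t ∈ KZ.openOrderedSimplex 3) :
    layerF N β₀ (b + 1) c γ₂ α t - layerF (lowR1Q N Q b c) β₀ b (c + 1) γ₂ α t =
      layerF (ibpQ1 (C (-(1 / (b : ℚ))) * N + X 1 * Q) b c) β₀ (b + 1) (c + 1) γ₂ α t := by
  obtain ⟨h0, h1, h1', h2', hd⟩ := simplex3_facts ht
  have hb' : (b : ℝ) ≠ 0 := by exact_mod_cast (show b ≠ 0 by omega)
  simp only [layerF, lowR1Q, lowR1, corr1, ibpQ1, MvPolynomial.pderiv_C_mul, map_add, map_mul, map_sub, MvPolynomial.aeval_C,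
    MvPolynomial.aeval_X, map_natCast, map_one, one_div, eq_ratCast, Rat.cast_inv, Rat.cast_neg, Rat.cast_natCast]
  field_simp
  ring

/-- Auxiliary step `lowerT1'Q_identity`. [bookkeeping] -/
theorem lowerT1'Q_identity (N Q : MvPolynomial (Fin 3) ℚ) (β₀ b c γ₂ α : ℕ) (hb : 1 ≤ b) {t : Fin 3 → ℝ}
    (ht : t ∈ KZ.openOrderedSimplex 3) :
    layerF N β₀ (b + 1) (c + 1) γ₂ α t - layerF (lowR1'Q N Q b c) β₀ b (c + 1) γ₂ α t =
      layerF (ibpQ1 (C (-(1 / (b : ℚ))) * N + X 1 * Q) b c) β₀ (b + 1) (c + 1) γ₂ α t := by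
  obtain ⟨h0, h1, h1', h2', hd⟩ := simplex3_facts ht
  have hb' : (b : ℝ) ≠ 0 := by exact_mod_cast (show b ≠ 0 by omega)
  simp only [layerF, lowR1'Q, lowR1', corr1, ibpQ1, MvPolynomial.pderiv_C_mul, map_add, map_mul, map_sub, MvPolynomial.aeval_C,
    MvPolynomial.aeval_X, map_natCast, map_one, one_div, eq_ratCast, Rat.cast_inv, Rat.cast_neg, Rat.cast_natCast, Nat.cast_add]
  field_simp
  ring

end QGeneric

end Summit.KontsevichZagierPeriods.RootDecompZetaThreeFrontier.WordLayer

namespace Summit.KontsevichZagierPeriods.KontsevichZagierPeriods.Cruxes.GZNormalFormWThree.GZLadder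

open Set MeasureTheory Literature.NumberTheory.Transcendental
open Summit.KontsevichZagierPeriods.RootDecompZetaThreeFrontier
open Summit.KontsevichZagierPeriods.KontsevichZagierPeriods.Theorems.RootDecompZetaThreeFrontierWordMoves (measurableSet_simplex ibpQ1
  dualRep3 dualRep3_integrand mem_simplex_three_duΦ integrableOn_comp_duΦ)

/-- **Q-generic t₂-LOWERING STEP** (`α = a+1 ↦ a`, `γ₂ = g ↦ g+1`). -/
theorem lowerT2Q (N Q : MvPolynomial (Fin 3) ℚ) (β₀ β₁ γ₁ g a : ℕ) (ha : 1 ≤ a)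
    (hRint : IntegrableOn (WordLayer.layerF (WordLayer.lowR2Q N Q g a) β₀ β₁ γ₁ (g + 1) a) (KZ.openOrderedSimplex 3))
    (hR : ∀ s : KZ.IntegralRep 3, s.domain = simplex 3 →
      EqOn s.integrand (WordLayer.layerF (WordLayer.lowR2Q N Q g a) β₀ β₁ γ₁ (g + 1) a) s.domain → CongInto (layerThree ∪ gzLETwo) (KZ.of s))
    (r : KZ.IntegralRep 3) (hd : r.domain = simplex 3) (hi : EqOn r.integrand (WordLayer.layerF N β₀ β₁ γ₁ g (a + 1)) r.domain) :
    CongInto (layerThree ∪ gzLETwo) (KZ.of r) :=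
  stepT2 N (MvPolynomial.C (1 / (a : ℚ)) * N + (MvPolynomial.X 0 - MvPolynomial.X 2) * Q) (WordLayer.lowR2Q N Q g a)
    β₀ β₁ γ₁ g (a + 1) g a β₀ β₁ γ₁ (g + 1) a
    (fun t ht => by rw [← WordLayer.lowerT2Q_identity N Q β₀ β₁ γ₁ g a ha ht]; ring) hRint hR r hd hi

/-- **Q-generic γ₂-LOWERING STEP** (`γ₂ = g+1 ↦ g`, `α = a ↦ a+1`). -/
theorem lowerC2Q (N Q : MvPolynomial (Fin 3) ℚ) (β₀ β₁ γ₁ g a : ℕ) (hg : 1 ≤ g)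
    (hRint : IntegrableOn (WordLayer.layerF (WordLayer.lowRc2Q N Q g a) β₀ β₁ γ₁ g (a + 1)) (KZ.openOrderedSimplex 3))
    (hR : ∀ s : KZ.IntegralRep 3, s.domain = simplex 3 →
      EqOn s.integrand (WordLayer.layerF (WordLayer.lowRc2Q N Q g a) β₀ β₁ γ₁ g (a + 1)) s.domain → CongInto (layerThree ∪ gzLETwo) (KZ.of s))
    (r : KZ.IntegralRep 3) (hd : r.domain = simplex 3) (hi : EqOn r.integrand (WordLayer.layerF N β₀ β₁ γ₁ (g + 1) a) r.domain) :
    CongInto (layerThree ∪ gzLETwo) (KZ.of r) :=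
  stepT2 N (MvPolynomial.C (1 / (g : ℚ)) * N + (MvPolynomial.C 1 - MvPolynomial.X 2) * Q) (WordLayer.lowRc2Q N Q g a)
    β₀ β₁ γ₁ (g + 1) a g a β₀ β₁ γ₁ g (a + 1)
    (fun t ht => by rw [← WordLayer.lowerC2Q_identity N Q β₀ β₁ γ₁ g a hg ht]; ring) hRint hR r hd hi

end Summit.KontsevichZagierPeriods.KontsevichZagierPeriods.Cruxes.GZNormalFormWThree.GZLadder
end
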